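import Mathlib
import Summits.ValiantsHypothesis.ValiantsHypothesis.Theorems.KPlusLogSqLawTridiagonalRealStaticGapProductHoles
import Summits.ValiantsHypothesis.ValiantsHypothesis.Theorems.KPlusLogSqLawTridiagonalRealStaticMatchingsFib

/-!
# The HOLE CRITERION of the α register (all sizes): the universal single-face law with holes

Sequel of `…TridiagonalRealStaticFullSpanFaceLaw.lean` (this lineage's ENS lane; static symmetric tridiagonal register of `WeakLifting`,
stmt-ValiantsHypothesis-19561).  Design `(a, d, b, f)`, `a_j b_j ≠ 0`, integer edge slopes `L_j = 2f_j − d_j − d_{j+1}`, `D_m = pathDet a d b f m`.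

**`card_posRoots_add_two_le_card_matchings_of_holes`** — every slope divisible by `g ≥ 1`; two NON-ADJACENT links `k + 2 ≤ l ≤ m − 2` with
`|L_k|, |L_l| = p·g, q·g` (`1 ≤ p < q`, either order, any signs); `lo := min(0,L_k) + min(0,L_l)` the lowest face value; a set `U` of HOLE
OFFSETS `i` (`0 < i < p+q`, `i ≠ p, q`) such that NO matching of `P_m` has slope-sum `lo + i·g` for `i ∈ U` while EVERY other offset
`0 < i < p+q` is attained; and the HOLE CONDITION `∏_{i∈U} i(p+q−i) ≤ ∏_{i∈U} |i−p|·|i−q|` ⇒ `Z(D_m) + 2 ≤ #matchings(P_m) = F_{m+1}`.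
`U = ∅` is the full-occupancy law; this is the complete UNIVERSAL (external-position-free) single-face obstruction: a Descartes–Fibonacci
sharp design leaves in every face span a hole set with `∏ ρ(i) > 1`, `ρ(i) = i(p+q−i)/(|i−p||i−q|)` (holes strictly between the middles have
`ρ > 1`).  Core `holes_core`; arithmetic `…GapProductHoles.lean`.

HONEST FRAMING: an all-sizes sector law with an occupancy/hole hypothesis; B5 = 7, B6 ∈ [9, 12] and «α NO MOVER» unchanged; nothing on
`WeakLifting`/`TropicalB` windows, Conjecture B, the doors, `MatrixDescartes` (18050) or `VP ≠ VNP`.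
Seat: prover val-sym-lift-p2 g18, `--supports stmt-ValiantsHypothesis-19561`.
-/

set_option linter.dupNamespace false
set_option autoImplicit false

namespace Summit.ValiantsHypothesis.ValiantsHypothesis.Theorems.KPlusLogSqLaw

namespace EdgeNormalForm

open Polynomial Finset
open Summit.ValiantsHypothesis.ValiantsHypothesis.Theorems.KPlusLogSqLaw.StaticTridiagonalRealPotential (pathDet)

variable (a : ℕ → ℝ) (d : ℕ → ℕ) (b : ℕ → ℝ) (f : ℕ → ℕ)

/-- **core of the hole criterion**: a would-be sharp design (`#matchings ≤ Z + 1`, injective matching sums) cannot carry a face of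
matchings `E₁, M₁, M₂, E₂` with integer slope-sums `c, c + p g, c + q g, c + (p+q) g` (`1 ≤ p < q`, all slopes divisible by `g`), balanced
coefficient moduli, holes `U` obeying the hole condition and occupancy of every other interior lattice point. [this work] -/
theorem holes_core (m g p q : ℕ) (ha : ∀ j, a j ≠ 0) (hb : ∀ j, b j ≠ 0)
    (hg : 1 ≤ g) (hdiv : ∀ j, j + 2 ≤ m → (g : ℤ) ∣ 2 * (f j : ℤ) - d j - d (j + 1)) (hp : 1 ≤ p) (hpq : p < q)
    (hsharp : ((range (m - 1)).powerset.filter (fun M : Finset ℕ => ∀ j ∈ M, j + 1 ∉ M)).card ≤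
      ((pathDet a d b f m).roots.toFinset.filter (fun x => 0 < x)).card + 1)
    (hinjz : ∀ M ∈ (range (m - 1)).powerset.filter (fun M : Finset ℕ => ∀ j ∈ M, j + 1 ∉ M),
      ∀ M' ∈ (range (m - 1)).powerset.filter (fun M : Finset ℕ => ∀ j ∈ M, j + 1 ∉ M),
      ∑ j ∈ M, (2 * (f j : ℤ) - d j - d (j + 1)) = ∑ j ∈ M', (2 * (f j : ℤ) - d j - d (j + 1)) → M = M')
    (c : ℤ) {E₁ M₁ M₂ E₂ : Finset ℕ}
    (hE₁ : E₁ ∈ (range (m - 1)).powerset.filter (fun M : Finset ℕ => ∀ j ∈ M, j + 1 ∉ M))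
    (hM₁ : M₁ ∈ (range (m - 1)).powerset.filter (fun M : Finset ℕ => ∀ j ∈ M, j + 1 ∉ M))
    (hM₂ : M₂ ∈ (range (m - 1)).powerset.filter (fun M : Finset ℕ => ∀ j ∈ M, j + 1 ∉ M))
    (hE₂ : E₂ ∈ (range (m - 1)).powerset.filter (fun M : Finset ℕ => ∀ j ∈ M, j + 1 ∉ M))
    (zE₁ : ∑ j ∈ E₁, (2 * (f j : ℤ) - d j - d (j + 1)) = c)
    (zM₁ : ∑ j ∈ M₁, (2 * (f j : ℤ) - d j - d (j + 1)) = c + p * g)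
    (zM₂ : ∑ j ∈ M₂, (2 * (f j : ℤ) - d j - d (j + 1)) = c + q * g)
    (zE₂ : ∑ j ∈ E₂, (2 * (f j : ℤ) - d j - d (j + 1)) = c + (p + q : ℕ) * g)
    (hcoef : (∏ j ∈ E₁, b j ^ 2 / |a j * a (j + 1)|) * (∏ j ∈ E₂, b j ^ 2 / |a j * a (j + 1)|) =
      (∏ j ∈ M₁, b j ^ 2 / |a j * a (j + 1)|) * (∏ j ∈ M₂, b j ^ 2 / |a j * a (j + 1)|))
    (U : Finset ℕ) (hU : ∀ i ∈ U, 0 < i ∧ i < p + q ∧ i ≠ p ∧ i ≠ q)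
    (hhole : ∀ i ∈ U, ∀ M₀ ∈ (range (m - 1)).powerset.filter (fun M : Finset ℕ => ∀ j ∈ M, j + 1 ∉ M),
      ∑ j ∈ M₀, (2 * (f j : ℤ) - d j - d (j + 1)) ≠ c + i * g)
    (hρ : (∏ i ∈ U, ((i : ℝ) * ((p + q : ℕ) - (i : ℝ)))) ≤ ∏ i ∈ U, (|(i : ℝ) - p| * |(i : ℝ) - q|))
    (hocc : ∀ i : ℕ, 0 < i → i < p + q → i ∉ U → ∃ M₀ ∈ (range (m - 1)).powerset.filter (fun M : Finset ℕ => ∀ j ∈ M, j + 1 ∉ M),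
      ∑ j ∈ M₀, (2 * (f j : ℤ) - d j - d (j + 1)) = c + i * g) : False := by
  -- the data of `faceRule_of_sharp`
  set zs : Finset ℕ → ℤ := fun M => ∑ j ∈ M, (2 * (f j : ℤ) - d j - d (j + 1)) with hzs
  set S : Finset (Finset ℕ) := (range (m - 1)).powerset with hSdef
  set σ : ↥S → ℝ := fun M => ∑ j ∈ (M : Finset ℕ), (2 * (f j : ℝ) - d j - d (j + 1)) with hσ
  set z : ↥S → ℤ := fun M => zs (M : Finset ℕ) with hz
  have hσz : ∀ M : ↥S, σ M = ((z M : ℤ) : ℝ) := fun M => by simp only [hσ, hz, hzs]; push_cast; rfl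
  set Act : Finset ↥S := Finset.univ.filter fun (M : ↥S) => ∀ j ∈ (M : Finset ℕ), j + 1 ∉ (M : Finset ℕ) with hAct
  have hmemAct : ∀ M : ↥S, M ∈ Act ↔ ∀ j ∈ (M : Finset ℕ), j + 1 ∉ (M : Finset ℕ) := fun M => by
    simp only [hAct, Finset.mem_filter, Finset.mem_univ, true_and]
  have hfilt : ∀ M : ↥S, M ∈ Act → (M : Finset ℕ) ∈ S.filter (fun M : Finset ℕ => ∀ j ∈ M, j + 1 ∉ M) := fun M hM =>
    Finset.mem_filter.mpr ⟨M.2, (hmemAct M).mp hM⟩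
  have hActmap : Act.map (Function.Embedding.subtype _) = S.filter (fun M : Finset ℕ => ∀ j ∈ M, j + 1 ∉ M) := by
    ext N
    rw [Finset.mem_map, Finset.mem_filter]
    constructor
    · rintro ⟨M, hM, rfl⟩
      exact ⟨M.2, (Finset.mem_filter.mp hM).2⟩
    · rintro ⟨hN, hP⟩
      exact ⟨⟨N, hN⟩, Finset.mem_filter.mpr ⟨Finset.mem_univ _, hP⟩, rfl⟩
  have hsharp' : Act.card ≤ ((pathDet a d b f m).roots.toFinset.filter fun x => 0 < x).card + 1 := by
    rw [← Finset.card_map (Function.Embedding.subtype _), hActmap]; exact hsharp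
  have hinjσ : ∀ M ∈ Act, ∀ M' ∈ Act, σ M = σ M' → M = M' := by
    intro M hM M' hM' h
    have hzz : zs M = zs M' := by
      have : ((zs M : ℤ) : ℝ) = ((zs M' : ℤ) : ℝ) := by rw [← hσz M, ← hσz M']; exact h
      exact_mod_cast this
    exact Subtype.ext (hinjz _ (hfilt M hM) _ (hfilt M' hM') hzz)
  have hinjz' : ∀ M ∈ Act, ∀ M' ∈ Act, z M = z M' → M = M' := fun M hM M' hM' h =>
    hinjσ M hM M' hM' (by rw [hσz, hσz, h])
  -- the four face members as elements of `Act`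
  have mem : ∀ {N : Finset ℕ}, N ∈ S.filter (fun M : Finset ℕ => ∀ j ∈ M, j + 1 ∉ M) → N ∈ S := fun h => (Finset.mem_filter.mp h).1
  have act : ∀ {N : Finset ℕ} (h : N ∈ S.filter (fun M : Finset ℕ => ∀ j ∈ M, j + 1 ∉ M)), (⟨N, mem h⟩ : ↥S) ∈ Act :=
    fun h => (hmemAct _).mpr (Finset.mem_filter.mp h).2
  have hg' : (0 : ℤ) < g := by exact_mod_cast hg
  have hgR : (0 : ℝ) < g := by exact_mod_cast hg
  have hpR : (1 : ℝ) ≤ p := by exact_mod_cast hp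
  have hpqR : (p : ℝ) < q := by exact_mod_cast hpq
  have hpg : (0 : ℝ) < (p : ℝ) * g := by positivity
  have hqpg : (p : ℝ) * g < (q : ℝ) * g := mul_lt_mul_of_pos_right hpqR hgR
  have vE₁ : z ⟨E₁, mem hE₁⟩ = c := zE₁
  have vM₁ : z ⟨M₁, mem hM₁⟩ = c + p * g := zM₁
  have vM₂ : z ⟨M₂, mem hM₂⟩ = c + q * g := zM₂
  have vE₂ : z ⟨E₂, mem hE₂⟩ = c + (p + q : ℕ) * g := zE₂
  have key := faceRule_of_sharp a d b f m ha hb σ rfl Act rfl hinjσ hsharp' (act hE₁) (act hM₁) (act hM₂) (act hE₂)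
    (by rw [hσz, hσz, vE₁, vM₁]; push_cast; linarith)
    (by rw [hσz, hσz, vM₁, vM₂]; push_cast; linarith)
    (by rw [hσz, hσz, vM₂, vE₂]; push_cast; linarith)
    (by rw [hσz, hσz, hσz, hσz, vE₁, vM₁, vM₂, vE₂]; push_cast; ring)
    hcoef
  simp_rw [hσz] at key
  -- lattice and occupancy
  have hmodc : ∀ Q ∈ Act, (g : ℤ) ∣ z Q - c := by
    intro Q hQ
    have hQ0 : (g : ℤ) ∣ z Q := by
      refine Finset.dvd_sum fun j hj => hdiv j ?_
      have := Finset.mem_range.mp (Finset.mem_powerset.mp Q.2 hj)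
      omega
    have hE0 : (g : ℤ) ∣ z ⟨E₁, mem hE₁⟩ := by
      refine Finset.dvd_sum fun j hj => hdiv j ?_
      have := Finset.mem_range.mp (Finset.mem_powerset.mp (mem hE₁) hj)
      omega
    rw [vE₁] at hE0
    exact dvd_sub hQ0 hE0
  have hocc' : ∀ i : ℕ, i ≤ p + q → i ∉ U → ∃ Q ∈ Act, z Q = c + i * g := by
    intro i hi hiU
    rcases Nat.eq_zero_or_pos i with h0 | hipos
    · exact ⟨⟨E₁, mem hE₁⟩, act hE₁, by rw [vE₁, h0]; push_cast; ring⟩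
    rcases eq_or_lt_of_le hi with htop | hlt
    · exact ⟨⟨E₂, mem hE₂⟩, act hE₂, by rw [vE₂, htop]⟩
    obtain ⟨M₀, hM₀, hM₀sum⟩ := hocc i hipos hlt hiU
    exact ⟨⟨M₀, mem hM₀⟩, act hM₀, hM₀sum⟩
  have hhole' : ∀ i ∈ U, ∀ Q ∈ Act, z Q ≠ c + i * g := fun i hi Q hQ => hhole i hi _ (hfilt Q hQ)
  exact absurd key (not_le.mpr (gapProduct_holes Act z hinjz' p q hp hpq c g hg' hmodc U hU hocc' hhole' hρ
    (act hE₁) (act hM₁) (act hM₂) (act hE₂) vE₁ vM₁ vM₂ vE₂))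

/-- **THE HOLE CRITERION (all sizes, lattice form).** [this work] -/
theorem card_posRoots_add_two_le_card_matchings_of_holes (m k l g p q : ℕ) (ha : ∀ j, a j ≠ 0) (hb : ∀ j, b j ≠ 0)
    (hg : 1 ≤ g) (hdiv : ∀ j, j + 2 ≤ m → (g : ℤ) ∣ 2 * (f j : ℤ) - d j - d (j + 1))
    (hkl : k + 2 ≤ l) (hlm : l + 2 ≤ m) (hp : 1 ≤ p) (hpq : p < q)
    (hface : ((2 * (f k : ℤ) - d k - d (k + 1)).natAbs = p * g ∧ (2 * (f l : ℤ) - d l - d (l + 1)).natAbs = q * g) ∨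
      ((2 * (f k : ℤ) - d k - d (k + 1)).natAbs = q * g ∧ (2 * (f l : ℤ) - d l - d (l + 1)).natAbs = p * g))
    (U : Finset ℕ) (hU : ∀ i ∈ U, 0 < i ∧ i < p + q ∧ i ≠ p ∧ i ≠ q)
    (hhole : ∀ i ∈ U, ∀ M₀ ∈ (range (m - 1)).powerset.filter (fun M : Finset ℕ => ∀ j ∈ M, j + 1 ∉ M),
      ∑ j ∈ M₀, (2 * (f j : ℤ) - d j - d (j + 1)) ≠
        (min 0 (2 * (f k : ℤ) - d k - d (k + 1)) + min 0 (2 * (f l : ℤ) - d l - d (l + 1))) + i * g)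
    (hρ : (∏ i ∈ U, ((i : ℝ) * ((p + q : ℕ) - (i : ℝ)))) ≤ ∏ i ∈ U, (|(i : ℝ) - p| * |(i : ℝ) - q|))
    (hocc : ∀ i : ℕ, 0 < i → i < p + q → i ∉ U →
      ∃ M₀ ∈ (range (m - 1)).powerset.filter (fun M : Finset ℕ => ∀ j ∈ M, j + 1 ∉ M),
        ∑ j ∈ M₀, (2 * (f j : ℤ) - d j - d (j + 1)) =
          (min 0 (2 * (f k : ℤ) - d k - d (k + 1)) + min 0 (2 * (f l : ℤ) - d l - d (l + 1))) + i * g) :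
    ((pathDet a d b f m).roots.toFinset.filter (fun x => 0 < x)).card + 2 ≤
      ((range (m - 1)).powerset.filter (fun M : Finset ℕ => ∀ j ∈ M, j + 1 ∉ M)).card := by
  by_contra hcon
  rw [not_le] at hcon
  have hsharp : ((range (m - 1)).powerset.filter (fun M : Finset ℕ => ∀ j ∈ M, j + 1 ∉ M)).card ≤
      ((pathDet a d b f m).roots.toFinset.filter (fun x => 0 < x)).card + 1 := by omega
  -- injectivity of matching sums (else the coincidence row contradicts `hcon`)
  have hinjz : ∀ M ∈ (range (m - 1)).powerset.filter (fun M : Finset ℕ => ∀ j ∈ M, j + 1 ∉ M),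
      ∀ M' ∈ (range (m - 1)).powerset.filter (fun M : Finset ℕ => ∀ j ∈ M, j + 1 ∉ M),
      ∑ j ∈ M, (2 * (f j : ℤ) - d j - d (j + 1)) = ∑ j ∈ M', (2 * (f j : ℤ) - d j - d (j + 1)) → M = M' := by
    intro M hM M' hM' h
    by_contra hne
    have := card_posRoots_add_two_le_of_coincidence a d b f m hM hM' hne h
    omega
  -- the four face matchings
  have hkl' : k ≠ l := by omega
  have me : (∅ : Finset ℕ) ∈ (range (m - 1)).powerset.filter (fun M : Finset ℕ => ∀ j ∈ M, j + 1 ∉ M) := by simp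
  have mk : ({k} : Finset ℕ) ∈ (range (m - 1)).powerset.filter (fun M : Finset ℕ => ∀ j ∈ M, j + 1 ∉ M) := by
    rw [Finset.mem_filter, Finset.mem_powerset, Finset.singleton_subset_iff, Finset.mem_range]
    refine ⟨by omega, fun j hj hj' => ?_⟩
    rw [Finset.mem_singleton] at hj hj'; omega
  have ml : ({l} : Finset ℕ) ∈ (range (m - 1)).powerset.filter (fun M : Finset ℕ => ∀ j ∈ M, j + 1 ∉ M) := by
    rw [Finset.mem_filter, Finset.mem_powerset, Finset.singleton_subset_iff, Finset.mem_range]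
    refine ⟨by omega, fun j hj hj' => ?_⟩
    rw [Finset.mem_singleton] at hj hj'; omega
  have mkl : ({k, l} : Finset ℕ) ∈ (range (m - 1)).powerset.filter (fun M : Finset ℕ => ∀ j ∈ M, j + 1 ∉ M) := by
    rw [Finset.mem_filter, Finset.mem_powerset, Finset.insert_subset_iff, Finset.singleton_subset_iff, Finset.mem_range,
      Finset.mem_range]
    refine ⟨⟨by omega, by omega⟩, fun j hj hj' => ?_⟩
    rw [Finset.mem_insert, Finset.mem_singleton] at hj hj'; omega
  -- integer values on the face
  set u : ℤ := 2 * (f k : ℤ) - d k - d (k + 1) with hu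
  set v : ℤ := 2 * (f l : ℤ) - d l - d (l + 1) with hv
  have ze : ∑ j ∈ (∅ : Finset ℕ), (2 * (f j : ℤ) - d j - d (j + 1)) = 0 := Finset.sum_empty
  have zk : ∑ j ∈ ({k} : Finset ℕ), (2 * (f j : ℤ) - d j - d (j + 1)) = u := Finset.sum_singleton _ _
  have zl : ∑ j ∈ ({l} : Finset ℕ), (2 * (f j : ℤ) - d j - d (j + 1)) = v := Finset.sum_singleton _ _
  have zkl : ∑ j ∈ ({k, l} : Finset ℕ), (2 * (f j : ℤ) - d j - d (j + 1)) = u + v := Finset.sum_pair hkl'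
  -- coefficient moduli of the four face matchings
  set gq : ℕ → ℝ := fun j => b j ^ 2 / |a j * a (j + 1)| with hgq
  have pe : ∏ j ∈ (∅ : Finset ℕ), gq j = 1 := Finset.prod_empty
  have pk : ∏ j ∈ ({k} : Finset ℕ), gq j = gq k := Finset.prod_singleton _ _
  have pl : ∏ j ∈ ({l} : Finset ℕ), gq j = gq l := Finset.prod_singleton _ _
  have pkl : ∏ j ∈ ({k, l} : Finset ℕ), gq j = gq k * gq l := Finset.prod_pair hkl'
  have hgu : (g : ℤ) ∣ u := hdiv k (by omega)
  have hgv : (g : ℤ) ∣ v := hdiv l (by omega)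
  have hg' : (0 : ℤ) < g := by exact_mod_cast hg
  -- occupancy / holes in offset form, given `c = min …`
  have core : ∀ (c : ℤ) {E₁ M₁ M₂ E₂ : Finset ℕ},
      E₁ ∈ (range (m - 1)).powerset.filter (fun M : Finset ℕ => ∀ j ∈ M, j + 1 ∉ M) →
      M₁ ∈ (range (m - 1)).powerset.filter (fun M : Finset ℕ => ∀ j ∈ M, j + 1 ∉ M) →
      M₂ ∈ (range (m - 1)).powerset.filter (fun M : Finset ℕ => ∀ j ∈ M, j + 1 ∉ M) →
      E₂ ∈ (range (m - 1)).powerset.filter (fun M : Finset ℕ => ∀ j ∈ M, j + 1 ∉ M) →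
      ∑ j ∈ E₁, (2 * (f j : ℤ) - d j - d (j + 1)) = c → ∑ j ∈ M₁, (2 * (f j : ℤ) - d j - d (j + 1)) = c + p * g →
      ∑ j ∈ M₂, (2 * (f j : ℤ) - d j - d (j + 1)) = c + q * g → ∑ j ∈ E₂, (2 * (f j : ℤ) - d j - d (j + 1)) = c + (p + q : ℕ) * g →
      c = min 0 u + min 0 v → c + (p + q : ℕ) * g = max 0 u + max 0 v →
      (∏ j ∈ E₁, gq j) * (∏ j ∈ E₂, gq j) = (∏ j ∈ M₁, gq j) * (∏ j ∈ M₂, gq j) → False := by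
    intro c E₁ M₁ M₂ E₂ hE₁ hM₁ hM₂ hE₂ zE₁ zM₁ zM₂ zE₂ hcmin _hcmax hcoef
    refine holes_core a d b f m g p q ha hb hg hdiv hp hpq hsharp hinjz c hE₁ hM₁ hM₂ hE₂ zE₁ zM₁ zM₂ zE₂ hcoef U hU
      (fun i hi M₀ hM₀ => by rw [hcmin]; exact hhole i hi M₀ hM₀) hρ ?_
    intro i hipos hlt hiU
    rw [hcmin]
    exact hocc i hipos hlt hiU
  -- the eight sign cases
  rcases hface with ⟨hua, hva⟩ | ⟨hua, hva⟩
  · have hu2 : u = p * g ∨ u = -(p * g) := by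
      have h := Int.natAbs_eq_iff.mp hua; push_cast at h; exact h
    have hv2 : v = q * g ∨ v = -(q * g) := by
      have h := Int.natAbs_eq_iff.mp hva; push_cast at h; exact h
    have hp0 : (0 : ℤ) < p := by exact_mod_cast (show 0 < p by omega)
    have hq0 : (0 : ℤ) < q := by exact_mod_cast (show 0 < q by omega)
    have hg0' : (0 : ℤ) < g := by exact_mod_cast hg
    have hpg : (0 : ℤ) < p * g := mul_pos hp0 hg0'
    have hqg : (0 : ℤ) < q * g := mul_pos hq0 hg0'
    have mu_pos : ∀ {w : ℤ}, 0 < w → min 0 w = 0 := fun h => min_eq_left h.le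
    have mu_neg : ∀ {w : ℤ}, 0 < w → min 0 (-w) = -w := fun h => min_eq_right (neg_nonpos.mpr h.le)
    have Mu_pos : ∀ {w : ℤ}, 0 < w → max 0 w = w := fun h => max_eq_right h.le
    have Mu_neg : ∀ {w : ℤ}, 0 < w → max 0 (-w) = 0 := fun h => max_eq_left (neg_nonpos.mpr h.le)
    rcases hu2 with hu1 | hu1 <;> rcases hv2 with hv1 | hv1
    · exact core 0 me mk ml mkl
        (by linear_combination (norm := (push_cast; ring)) ze)
        (by linear_combination (norm := (push_cast; ring)) zk + hu1)
        (by linear_combination (norm := (push_cast; ring)) zl + hv1)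
        (by linear_combination (norm := (push_cast; ring)) zkl + hu1 + hv1)
        (by rw [hu1, hv1]; linear_combination (norm := (push_cast; ring)) (-1 : ℤ) * (mu_pos hpg) + (-1 : ℤ) * (mu_pos hqg))
        (by rw [hu1, hv1]; linear_combination (norm := (push_cast; ring)) (-1 : ℤ) * (Mu_pos hpg) + (-1 : ℤ) * (Mu_pos hqg)) (by
          show (∏ j ∈ (∅ : Finset ℕ), gq j) * (∏ j ∈ ({k, l} : Finset ℕ), gq j) =
            (∏ j ∈ ({k} : Finset ℕ), gq j) * (∏ j ∈ ({l} : Finset ℕ), gq j)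
          rw [pkl, pe, pk, pl]; ring)
    · exact core (-(q * g : ℤ)) ml mkl me mk
        (by linear_combination (norm := (push_cast; ring)) zl + hv1)
        (by linear_combination (norm := (push_cast; ring)) zkl + hu1 + hv1)
        (by linear_combination (norm := (push_cast; ring)) ze)
        (by linear_combination (norm := (push_cast; ring)) zk + hu1)
        (by rw [hu1, hv1]; linear_combination (norm := (push_cast; ring)) (-1 : ℤ) * (mu_pos hpg) + (-1 : ℤ) * (mu_neg hqg))
        (by rw [hu1, hv1]; linear_combination (norm := (push_cast; ring)) (-1 : ℤ) * (Mu_pos hpg) + (-1 : ℤ) * (Mu_neg hqg)) (by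
          show (∏ j ∈ ({l} : Finset ℕ), gq j) * (∏ j ∈ ({k} : Finset ℕ), gq j) =
            (∏ j ∈ ({k, l} : Finset ℕ), gq j) * (∏ j ∈ (∅ : Finset ℕ), gq j)
          rw [pkl, pe, pk, pl]; ring)
    · exact core (-(p * g : ℤ)) mk me mkl ml
        (by linear_combination (norm := (push_cast; ring)) zk + hu1)
        (by linear_combination (norm := (push_cast; ring)) ze)
        (by linear_combination (norm := (push_cast; ring)) zkl + hu1 + hv1)
        (by linear_combination (norm := (push_cast; ring)) zl + hv1)
        (by rw [hu1, hv1]; linear_combination (norm := (push_cast; ring)) (-1 : ℤ) * (mu_neg hpg) + (-1 : ℤ) * (mu_pos hqg))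
        (by rw [hu1, hv1]; linear_combination (norm := (push_cast; ring)) (-1 : ℤ) * (Mu_neg hpg) + (-1 : ℤ) * (Mu_pos hqg)) (by
          show (∏ j ∈ ({k} : Finset ℕ), gq j) * (∏ j ∈ ({l} : Finset ℕ), gq j) =
            (∏ j ∈ (∅ : Finset ℕ), gq j) * (∏ j ∈ ({k, l} : Finset ℕ), gq j)
          rw [pkl, pe, pk, pl]; ring)
    · exact core (-((p + q : ℕ) * g : ℤ)) mkl ml mk me
        (by linear_combination (norm := (push_cast; ring)) zkl + hu1 + hv1)
        (by linear_combination (norm := (push_cast; ring)) zl + hv1)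
        (by linear_combination (norm := (push_cast; ring)) zk + hu1)
        (by linear_combination (norm := (push_cast; ring)) ze)
        (by rw [hu1, hv1]; linear_combination (norm := (push_cast; ring)) (-1 : ℤ) * (mu_neg hpg) + (-1 : ℤ) * (mu_neg hqg))
        (by rw [hu1, hv1]; linear_combination (norm := (push_cast; ring)) (-1 : ℤ) * (Mu_neg hpg) + (-1 : ℤ) * (Mu_neg hqg)) (by
          show (∏ j ∈ ({k, l} : Finset ℕ), gq j) * (∏ j ∈ (∅ : Finset ℕ), gq j) =
            (∏ j ∈ ({l} : Finset ℕ), gq j) * (∏ j ∈ ({k} : Finset ℕ), gq j)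
          rw [pkl, pe, pk, pl]; ring)
  · have hu2 : u = q * g ∨ u = -(q * g) := by
      have h := Int.natAbs_eq_iff.mp hua; push_cast at h; exact h
    have hv2 : v = p * g ∨ v = -(p * g) := by
      have h := Int.natAbs_eq_iff.mp hva; push_cast at h; exact h
    have hp0 : (0 : ℤ) < p := by exact_mod_cast (show 0 < p by omega)
    have hq0 : (0 : ℤ) < q := by exact_mod_cast (show 0 < q by omega)
    have hg0' : (0 : ℤ) < g := by exact_mod_cast hg
    have hpg : (0 : ℤ) < p * g := mul_pos hp0 hg0'
    have hqg : (0 : ℤ) < q * g := mul_pos hq0 hg0'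
    have mu_pos : ∀ {w : ℤ}, 0 < w → min 0 w = 0 := fun h => min_eq_left h.le
    have mu_neg : ∀ {w : ℤ}, 0 < w → min 0 (-w) = -w := fun h => min_eq_right (neg_nonpos.mpr h.le)
    have Mu_pos : ∀ {w : ℤ}, 0 < w → max 0 w = w := fun h => max_eq_right h.le
    have Mu_neg : ∀ {w : ℤ}, 0 < w → max 0 (-w) = 0 := fun h => max_eq_left (neg_nonpos.mpr h.le)
    rcases hu2 with hu1 | hu1 <;> rcases hv2 with hv1 | hv1
    · exact core 0 me ml mk mkl
        (by linear_combination (norm := (push_cast; ring)) ze)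
        (by linear_combination (norm := (push_cast; ring)) zl + hv1)
        (by linear_combination (norm := (push_cast; ring)) zk + hu1)
        (by linear_combination (norm := (push_cast; ring)) zkl + hu1 + hv1)
        (by rw [hu1, hv1]; linear_combination (norm := (push_cast; ring)) (-1 : ℤ) * (mu_pos hqg) + (-1 : ℤ) * (mu_pos hpg))
        (by rw [hu1, hv1]; linear_combination (norm := (push_cast; ring)) (-1 : ℤ) * (Mu_pos hqg) + (-1 : ℤ) * (Mu_pos hpg)) (by
          show (∏ j ∈ (∅ : Finset ℕ), gq j) * (∏ j ∈ ({k, l} : Finset ℕ), gq j) =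
            (∏ j ∈ ({l} : Finset ℕ), gq j) * (∏ j ∈ ({k} : Finset ℕ), gq j)
          rw [pkl, pe, pk, pl]; ring)
    · exact core (-(p * g : ℤ)) ml me mkl mk
        (by linear_combination (norm := (push_cast; ring)) zl + hv1)
        (by linear_combination (norm := (push_cast; ring)) ze)
        (by linear_combination (norm := (push_cast; ring)) zkl + hu1 + hv1)
        (by linear_combination (norm := (push_cast; ring)) zk + hu1)
        (by rw [hu1, hv1]; linear_combination (norm := (push_cast; ring)) (-1 : ℤ) * (mu_pos hqg) + (-1 : ℤ) * (mu_neg hpg))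
        (by rw [hu1, hv1]; linear_combination (norm := (push_cast; ring)) (-1 : ℤ) * (Mu_pos hqg) + (-1 : ℤ) * (Mu_neg hpg)) (by
          show (∏ j ∈ ({l} : Finset ℕ), gq j) * (∏ j ∈ ({k} : Finset ℕ), gq j) =
            (∏ j ∈ (∅ : Finset ℕ), gq j) * (∏ j ∈ ({k, l} : Finset ℕ), gq j)
          rw [pkl, pe, pk, pl]; ring)
    · exact core (-(q * g : ℤ)) mk mkl me ml
        (by linear_combination (norm := (push_cast; ring)) zk + hu1)
        (by linear_combination (norm := (push_cast; ring)) zkl + hu1 + hv1)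
        (by linear_combination (norm := (push_cast; ring)) ze)
        (by linear_combination (norm := (push_cast; ring)) zl + hv1)
        (by rw [hu1, hv1]; linear_combination (norm := (push_cast; ring)) (-1 : ℤ) * (mu_neg hqg) + (-1 : ℤ) * (mu_pos hpg))
        (by rw [hu1, hv1]; linear_combination (norm := (push_cast; ring)) (-1 : ℤ) * (Mu_neg hqg) + (-1 : ℤ) * (Mu_pos hpg)) (by
          show (∏ j ∈ ({k} : Finset ℕ), gq j) * (∏ j ∈ ({l} : Finset ℕ), gq j) =
            (∏ j ∈ ({k, l} : Finset ℕ), gq j) * (∏ j ∈ (∅ : Finset ℕ), gq j)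
          rw [pkl, pe, pk, pl]; ring)
    · exact core (-((p + q : ℕ) * g : ℤ)) mkl mk ml me
        (by linear_combination (norm := (push_cast; ring)) zkl + hu1 + hv1)
        (by linear_combination (norm := (push_cast; ring)) zk + hu1)
        (by linear_combination (norm := (push_cast; ring)) zl + hv1)
        (by linear_combination (norm := (push_cast; ring)) ze)
        (by rw [hu1, hv1]; linear_combination (norm := (push_cast; ring)) (-1 : ℤ) * (mu_neg hqg) + (-1 : ℤ) * (mu_neg hpg))
        (by rw [hu1, hv1]; linear_combination (norm := (push_cast; ring)) (-1 : ℤ) * (Mu_neg hqg) + (-1 : ℤ) * (Mu_neg hpg)) (by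
          show (∏ j ∈ ({k, l} : Finset ℕ), gq j) * (∏ j ∈ (∅ : Finset ℕ), gq j) =
            (∏ j ∈ ({k} : Finset ℕ), gq j) * (∏ j ∈ ({l} : Finset ℕ), gq j)
          rw [pkl, pe, pk, pl]; ring)


/-- **THE HOLE CRITERION in register language**: `Z(D_m) + 2 ≤ F_{m+1}`. [this work] -/
theorem card_posRoots_add_two_le_fib_of_holes (m k l g p q : ℕ) (ha : ∀ j, a j ≠ 0) (hb : ∀ j, b j ≠ 0)
    (hg : 1 ≤ g) (hdiv : ∀ j, j + 2 ≤ m → (g : ℤ) ∣ 2 * (f j : ℤ) - d j - d (j + 1))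
    (hkl : k + 2 ≤ l) (hlm : l + 2 ≤ m) (hp : 1 ≤ p) (hpq : p < q)
    (hface : ((2 * (f k : ℤ) - d k - d (k + 1)).natAbs = p * g ∧ (2 * (f l : ℤ) - d l - d (l + 1)).natAbs = q * g) ∨
      ((2 * (f k : ℤ) - d k - d (k + 1)).natAbs = q * g ∧ (2 * (f l : ℤ) - d l - d (l + 1)).natAbs = p * g))
    (U : Finset ℕ) (hU : ∀ i ∈ U, 0 < i ∧ i < p + q ∧ i ≠ p ∧ i ≠ q)
    (hhole : ∀ i ∈ U, ∀ M₀ ∈ (range (m - 1)).powerset.filter (fun M : Finset ℕ => ∀ j ∈ M, j + 1 ∉ M),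
      ∑ j ∈ M₀, (2 * (f j : ℤ) - d j - d (j + 1)) ≠
        (min 0 (2 * (f k : ℤ) - d k - d (k + 1)) + min 0 (2 * (f l : ℤ) - d l - d (l + 1))) + i * g)
    (hρ : (∏ i ∈ U, ((i : ℝ) * ((p + q : ℕ) - (i : ℝ)))) ≤ ∏ i ∈ U, (|(i : ℝ) - p| * |(i : ℝ) - q|))
    (hocc : ∀ i : ℕ, 0 < i → i < p + q → i ∉ U →
      ∃ M₀ ∈ (range (m - 1)).powerset.filter (fun M : Finset ℕ => ∀ j ∈ M, j + 1 ∉ M),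
        ∑ j ∈ M₀, (2 * (f j : ℤ) - d j - d (j + 1)) =
          (min 0 (2 * (f k : ℤ) - d k - d (k + 1)) + min 0 (2 * (f l : ℤ) - d l - d (l + 1))) + i * g) :
    ((pathDet a d b f m).roots.toFinset.filter (fun x => 0 < x)).card + 2 ≤ Nat.fib (m + 1) := by
  have h := card_posRoots_add_two_le_card_matchings_of_holes a d b f m k l g p q ha hb hg hdiv hkl hlm hp hpq hface U hU hhole hρ hocc
  rwa [card_matchings_range, show m - 1 + 2 = m + 1 by omega] at h

end EdgeNormalForm

end Summit.ValiantsHypothesis.ValiantsHypothesis.Theorems.KPlusLogSqLaw
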